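import Mathlib
import HarnessLib

/-!
# Route `AdditiveKolyvaginRoad`: the TORUS CONJUGACY `α · K₀(p²) · α⁻¹ = K_T(p)` — first lemma of crux card `toric-newvector-switch`
# (crux KS′ `LevelKolyvaginSystemsAdditive`, item stmt-BirchSwinnertonDyer-21396; glue ∕ engine MODULE, triage round 1 PASS)
# (cell `pub/bsd-wall`, width seat `bsd-wall-akr-p2x-w4` g4; `--supports stmt-BirchSwinnertonDyer-21396`, helper)

THEOREMS ONLY (no definition, no named fact, no `sorry`); Mathlib-only content.  BSD is not proved by any of this; KS′ and KPA′
stay OPEN at `p² ∣ N`; nothing representation-theoretic (new vectors, toric periods) is asserted here.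

THE POINT.  The crux-ideation card `Cruxes/LevelKolyvaginSystemsAdditive/Ideas/toric-newvector-switch.md` (round 1, seat 2; triage
seat 1 g18: PASS as a glue ∕ engine module) rests on one local, elementary lever: for the torus element `α = diag(p, 1)` one has
`α · K₀(p²) · α⁻¹ = K_T(p) := {k ∈ GL₂(ℤ_p) : k ≡ diagonal (mod p)}`, so that for a depth-zero representation of `PGL₂(ℚ_p)` of
conductor `p²` (every additive prime `p ≥ 5` of an elliptic curve) the new line is `π(α⁻¹)` of the torus-fixed line of the `K`-type,
and toric period sums ∕ CM divisors of the newvector are those of the torus-fixed vector.  The card's typed sketch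
(`Cruxes/…/ToricNewvectorSwitchSketch.lean`, Mathlib-only `def … : Prop`s, «nothing to run») states the lever over `ℚ`-matrices with
integrality predicates as `ToricNewvectorSwitch.FirstLemma`, and the formal shadow of the period identity as
`ToricNewvectorSwitch.OrbitSumInvariance`.  This file PROVES both, with the sketch's predicates `IsIntegral ∕ InK0sq ∕ InKT ∕ alpha ∕
alphaInv` UNFOLDED (the Cruxes sketch is not importable from `Theorems/`), so that a skeleton on the card closes them by `exact`:

* `conj_alpha_eq` — the entries of `α M α⁻¹`: `(a, b; c, d) ↦ (a, p·b; c/p, d)` (`p ≠ 0`).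
* `firstLemma` — `M` is integral with `p² ∣ M₁₀` iff `α M α⁻¹` is integral with `p ∣ (α M α⁻¹)₀₁` and `p ∣ (α M α⁻¹)₁₀`
  (= `InK0sq p M ↔ InKT p (alpha p * M * alphaInv p)` unfolded), for every `p ≠ 0`.
* `orbitSumInvariance` — in a commutative monoid acting on a set, `Σ_{t ∈ S} f((t·a)•x) = Σ_{t ∈ S} f((a·t)•x)` (the sketch's
  statement verbatim; it holds by commutativity alone, its normalising hypothesis is not needed).

(The determinant ∕ unit conditions of `K₀(p²)`, `K_T(p)` agree on both sides since `det(α M α⁻¹) = det M`; the sketch omits them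
and so does this file.)

References: the card and sketch above; for the level structures, e.g. A. Pitale, A. Saha, R. Schmidt, *Mem. AMS* 1312 (2021) §2
(no result of theirs is used).
-/

-- D-0017: single-problem summit, so `Summit.BirchSwinnertonDyer.BirchSwinnertonDyer.…` repeats a namespace BY DESIGN.
set_option linter.dupNamespace false
set_option autoImplicit false

namespace Summit.BirchSwinnertonDyer.BirchSwinnertonDyer.Theorems.AdditiveKoly.ToricNewvectorSwitch

open Matrix

/-- **Entries of `α M α⁻¹` for `α = diag(p, 1)`:** `(a, b; c, d) ↦ (a, p·b; p⁻¹·c, d)` (`p ≠ 0`). [folklore] -/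
theorem conj_alpha_eq (p : ℕ) (hp : p ≠ 0) (M : Matrix (Fin 2) (Fin 2) ℚ) :
    !![(p : ℚ), 0; 0, 1] * M * !![((p : ℚ)⁻¹), 0; 0, 1] =
      !![M 0 0, (p : ℚ) * M 0 1; (p : ℚ)⁻¹ * M 1 0, M 1 1] := by
  have hp' : (p : ℚ) ≠ 0 := by exact_mod_cast hp
  ext i j
  fin_cases i <;> fin_cases j <;> simp only [Matrix.mul_apply, Fin.sum_univ_two] <;> simp <;> field_simp

/-- **FIRST LEMMA of crux card `toric-newvector-switch` (torus conjugacy of the two level structures; tree form of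
`ToricNewvectorSwitchSketch.FirstLemma`, predicates unfolded).**  For `p ≠ 0` and a rational `2 × 2` matrix `M`:
`M` has integral entries with lower-left entry divisible by `p²` (the `K₀(p²)`-shape `InK0sq p M`) iff `α M α⁻¹`, `α = diag(p,1)`,
has integral entries with both off-diagonal entries divisible by `p` (the `K_T(p)`-shape `InKT p (α M α⁻¹)`: congruent to a
diagonal matrix mod `p`).  Proof: `α M α⁻¹ = (a, p·b; c/p, d)`. [folklore] -/
theorem firstLemma (p : ℕ) (hp : p ≠ 0) (M : Matrix (Fin 2) (Fin 2) ℚ) :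
    ((∀ i j, ∃ z : ℤ, M i j = (z : ℚ)) ∧ ∃ z : ℤ, M 1 0 = ((p : ℚ) ^ 2) * (z : ℚ)) ↔
    ((∀ i j, ∃ z : ℤ, (!![(p : ℚ), 0; 0, 1] * M * !![((p : ℚ)⁻¹), 0; 0, 1]) i j = (z : ℚ)) ∧
      (∃ z : ℤ, (!![(p : ℚ), 0; 0, 1] * M * !![((p : ℚ)⁻¹), 0; 0, 1]) 0 1 = (p : ℚ) * (z : ℚ)) ∧
      ∃ z : ℤ, (!![(p : ℚ), 0; 0, 1] * M * !![((p : ℚ)⁻¹), 0; 0, 1]) 1 0 = (p : ℚ) * (z : ℚ)) := by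
  have hp' : (p : ℚ) ≠ 0 := by exact_mod_cast hp
  rw [conj_alpha_eq p hp M]
  constructor
  · rintro ⟨hint, z, hz⟩
    obtain ⟨a, ha⟩ := hint 0 0
    obtain ⟨b, hb⟩ := hint 0 1
    obtain ⟨d, hd⟩ := hint 1 1
    refine ⟨?_, ⟨b, by simp [hb]⟩, ⟨z, ?_⟩⟩
    · intro i j
      fin_cases i <;> fin_cases j
      · exact ⟨a, by simp [ha]⟩
      · exact ⟨p * b, by simp [hb]⟩
      · exact ⟨p * z, by simp [hz]; field_simp⟩
      · exact ⟨d, by simp [hd]⟩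
    · simp [hz]
      field_simp
  · rintro ⟨hint, ⟨z₁, hz₁⟩, ⟨z₂, hz₂⟩⟩
    simp only [of_apply, cons_val', cons_val_zero, cons_val_one, cons_val_fin_one, empty_val'] at hz₁ hz₂
    have hb : M 0 1 = (z₁ : ℚ) := mul_left_cancel₀ hp' hz₁
    have hc : M 1 0 = ((p : ℚ) ^ 2) * (z₂ : ℚ) := by
      field_simp at hz₂
      linear_combination hz₂
    obtain ⟨a, ha⟩ := hint 0 0
    obtain ⟨d, hd⟩ := hint 1 1
    simp only [of_apply, cons_val', cons_val_zero, cons_val_one, cons_val_fin_one, empty_val'] at ha hd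
    refine ⟨?_, z₂, hc⟩
    intro i j
    fin_cases i <;> fin_cases j
    · exact ⟨a, by simpa using ha⟩
    · exact ⟨z₁, by simpa using hb⟩
    · exact ⟨(p : ℤ) ^ 2 * z₂, by simp [hc]⟩
    · exact ⟨d, by simpa using hd⟩

/-- **`OrbitSumInvariance` of the sketch** (formal shadow of «toric periods of `π(α⁻¹)φ_T` and `φ_T` agree»): for a commutative
monoid `T` acting on `X`, a finite `S ⊆ T`, `a ∈ T`, `x ∈ X` and any `f : X → R`,
`Σ_{t ∈ S} f((t·a)•x) = Σ_{t ∈ S} f((a·t)•x)`.  Stated VERBATIM as in the sketch (including its normalising hypothesis, which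
commutativity makes idle). [folklore] -/
theorem orbitSumInvariance (T X R : Type) [CommMonoid T] [MulAction T X] [AddCommMonoid R]
    (S : Finset T) (a : T) (x : X) (f : X → R)
    (_h : ∀ t ∈ S, ∃ t' ∈ S, t * a = a * t') :
    (S.sum fun t => f ((t * a) • x)) = (S.sum fun t => f ((a * t) • x)) :=
  Finset.sum_congr rfl fun t _ => by rw [mul_comm t a]

end Summit.BirchSwinnertonDyer.BirchSwinnertonDyer.Theorems.AdditiveKoly.ToricNewvectorSwitch
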